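import Summits.Ventures.PercRepro.GenQTraceProfileA

/-!
# PercRepro — the trace profiles, part B: the profile rows of the hyperplane traces (night-4, gen 11)

A hyperplane trace `H ∩ G` (`H ∈ flatsTr M G r s`: a rank-`r` flat whose `s`-point trace spans it) is itself a
finite set of rank `r`, so the lane's profile rows (P1)–(P2) (`card_mul_card_Pc_eq_sum_mv`,
`succ_mul_card_Pc_eq_sum_mv`) and the empty classes (`card_Pc_eq_zero_of_nonbasis`, `card_Pc_eq_zero_of_basis`)
hold for it; `spFm` is its class count at the level `s − j` (`spFm_eq_card_Pc`).  Summing over the traces of one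
size gives the rows (T1)–(T4) of the two-level profile LP (sheet §65 (b) (T)) in the aggregates `spSumM` (part A) and
`mvSumM` (the moves of the traces' profiles, summed):

* (T1) `(s − k − m)·SPm_{s, s−k, m} = Σ_{m′ ∈ [m, r]} mvK_{s,k,m′,m}`;
* (T2) `(k + 1)·SPm_{s, s−k−1, m′} = Σ_{m ≤ m′} mvK_{s,k,m′,m}`, and (T3) `mvK_{s,k,m,m} ≤ (k + 1)·SPm_{s, s−k−1, m}`;
* (T4) `SPm_{s,j,m} = 0` for `j > r` and `m ≥ r − 1` (simple `M`: a rank-`1` cyclic part), and for `j = r`, `m ≠ r`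
  (every basis of the trace has `r` coloops).

Imports `GenQTraceProfileA`.
-/
namespace PercRepro.Night4

open Finset ThmH SixFour GenQ PerFlat Star

variable {α : Type*} [DecidableEq α] {M : Matroid α} [M.Finite]

/-- Membership in `flatsTr`. -/
theorem mem_flatsTr {G H : Finset α} {r s : ℕ} :
    H ∈ flatsTr M G r s ↔ H ∈ flatsQ M r ∧ (H ∩ G).card = s ∧ M.eRk ((H ∩ G : Finset α) : Set α) = (r : ℕ∞) := by
  unfold flatsTr
  rw [Finset.mem_filter]

/-- The trace's own profile: `spFm` is the class count `#Pc` of the trace `H ∩ G` at its level `s − j`. -/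
theorem spFm_eq_card_Pc {G H : Finset α} {r s j m : ℕ} (hs : (H ∩ G).card = s) (hj : j ≤ s) :
    spFm M G H r j m = (Pc M (H ∩ G) r (s - j) m).card := by
  unfold spFm
  congr 1
  ext T
  rw [Finset.mem_filter, Finset.mem_powersetCard, mem_Pc, mem_Rq]
  constructor
  · rintro ⟨⟨hT, hTc⟩, hr, hm⟩
    refine ⟨⟨hT, hr⟩, ?_, hm⟩
    rw [Finset.card_sdiff_of_subset hT, hs, hTc]
  · rintro ⟨⟨hT, hr⟩, hk, hm⟩
    refine ⟨⟨hT, ?_⟩, hr, hm⟩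
    have h1 := Finset.card_sdiff_of_subset hT
    have h2 := Finset.card_le_card hT
    rw [hs] at h1 h2
    omega

/-- The moves of the traces' profiles, summed over the `s`-point spanning traces:
`mvK_{s,k,m′,m} = Σ_{H ∈ flatsTr r s} mv (H ∩ G) r k m′ m`. -/
noncomputable def mvSumM (M : Matroid α) [M.Finite] (G : Finset α) (r s k m' m : ℕ) : ℕ :=
  ∑ H ∈ flatsTr M G r s, mv M (H ∩ G) r k m' m

/-- A move into a class below the coloop count of the whole set is empty (every spanning subset keeps the coloops
of the set). -/
theorem mv_eq_zero_of_lt_mTr {G : Finset α} {q : ℕ} (hG : G ⊆ gr M) (hrG : M.eRk (G : Set α) = (q : ℕ∞))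
    (k m' : ℕ) {m : ℕ} (hm : m < mTr M G) : mv M G q k m' m = 0 := by
  unfold mv
  refine Finset.sum_eq_zero (fun S hS => ?_)
  rw [Finset.card_eq_zero, Finset.filter_eq_empty_iff]
  intro x hx hmx
  have hS' := mem_Pc.1 hS
  have hR := mem_Rq.1 hS'.1
  have hxG := (Finset.mem_sdiff.1 hx).1
  have hins : insert x S ∈ Rq M G q := by
    rw [mem_Rq]
    refine ⟨Finset.insert_subset hxG hR.1, le_antisymm ?_ ?_⟩
    · rw [← hrG]
      exact M.eRk_mono (Finset.coe_subset.2 (Finset.insert_subset hxG hR.1))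
    · rw [← hR.2]
      exact M.eRk_mono (Finset.coe_subset.2 (Finset.subset_insert x S))
  have := mTr_le_of_mem_Rq hG hrG hins
  omega

/-- (P2) with the lower limit of the sum removed: `(k+1)·#Pc (k+1) m′ = Σ_{m ≤ m′} mv k m′ m`. -/
theorem succ_mul_card_Pc_eq_sum_range_mv {G : Finset α} {q : ℕ} (hG : G ⊆ gr M)
    (hrG : M.eRk (G : Set α) = (q : ℕ∞)) (k m' : ℕ) :
    (k + 1) * (Pc M G q (k + 1) m').card = ∑ m ∈ Finset.range (m' + 1), mv M G q k m' m := by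
  rw [succ_mul_card_Pc_eq_sum_mv hG hrG k m']
  refine Finset.sum_subset (fun m hm => ?_) (fun m hm hnot => ?_)
  · rw [Finset.mem_Icc] at hm
    rw [Finset.mem_range]
    omega
  · rw [Finset.mem_range] at hm
    rw [Finset.mem_Icc] at hnot
    exact mv_eq_zero_of_lt_mTr hG hrG k m' (by omega)

/-- The trace `H ∩ G` of `H ∈ flatsTr M G r s` is a finite subset of the ground set of rank `r` with `s` points. -/
theorem trace_facts_of_mem_flatsTr {G H : Finset α} {r s : ℕ} (hG : G ⊆ gr M) (hH : H ∈ flatsTr M G r s) :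
    H ∩ G ⊆ gr M ∧ M.eRk ((H ∩ G : Finset α) : Set α) = (r : ℕ∞) ∧ (H ∩ G).card = s :=
  ⟨Finset.inter_subset_right.trans hG, (mem_flatsTr.1 hH).2.2, (mem_flatsTr.1 hH).2.1⟩

/-- **(T1)** the rows (P1) of the traces, summed: `(s − k − m)·SPm_{s, s−k, m} = Σ_{m′ ∈ [m, r]} mvK_{s,k,m′,m}`. -/
theorem t1_row {G : Finset α} (hG : G ⊆ gr M) (r s k m : ℕ) (hk : k ≤ s) :
    (s - k - m) * spSumM M G r s (s - k) m = ∑ m' ∈ Finset.Icc m r, mvSumM M G r s k m' m := by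
  unfold spSumM mvSumM
  rw [Finset.mul_sum, Finset.sum_comm]
  refine Finset.sum_congr rfl (fun H hH => ?_)
  obtain ⟨hHG, hHr, hHs⟩ := trace_facts_of_mem_flatsTr hG hH
  rw [spFm_eq_card_Pc hHs (Nat.sub_le s k)]
  have hsk : s - (s - k) = k := by omega
  rw [hsk, ← hHs, card_mul_card_Pc_eq_sum_mv hHG hHr k m]

/-- **(T2)** the rows (P2) of the traces, summed: `(k + 1)·SPm_{s, s−k−1, m′} = Σ_{m ≤ m′} mvK_{s,k,m′,m}`. -/
theorem t2_row {G : Finset α} (hG : G ⊆ gr M) (r s k m' : ℕ) (hk : k + 1 ≤ s) :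
    (k + 1) * spSumM M G r s (s - k - 1) m' = ∑ m ∈ Finset.range (m' + 1), mvSumM M G r s k m' m := by
  unfold spSumM mvSumM
  rw [Finset.mul_sum, Finset.sum_comm]
  refine Finset.sum_congr rfl (fun H hH => ?_)
  obtain ⟨hHG, hHr, hHs⟩ := trace_facts_of_mem_flatsTr hG hH
  rw [spFm_eq_card_Pc hHs (by omega)]
  have hsk : s - (s - k - 1) = k + 1 := by omega
  rw [hsk, succ_mul_card_Pc_eq_sum_range_mv hHG hHr k m']

/-- **(T3)** the stays are at most the moves: `mvK_{s,k,m,m} ≤ (k + 1)·SPm_{s, s−k−1, m}`. -/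
theorem t3_row {G : Finset α} (hG : G ⊆ gr M) (r s k m : ℕ) (hk : k + 1 ≤ s) :
    mvSumM M G r s k m m ≤ (k + 1) * spSumM M G r s (s - k - 1) m := by
  rw [t2_row hG r s k m hk]
  exact Finset.single_le_sum (f := fun m'' => mvSumM M G r s k m m'') (fun _ _ => Nat.zero_le _)
    (Finset.mem_range.2 (Nat.lt_succ_self m))

/-- **(T4a)** the empty classes below the bases: for `j > r` no rank-`r` `j`-subset of a trace has `≥ r − 1` coloops
(simple `M`: its cyclic part would have rank `≤ 1`). -/
theorem spSumM_eq_zero_of_nonbasis (hs : Simple M) {G : Finset α} (hG : G ⊆ gr M) {r s j m : ℕ} (hr : 1 ≤ r)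
    (hj : r < j) (hjs : j ≤ s) (hm : r ≤ m + 1) : spSumM M G r s j m = 0 := by
  unfold spSumM
  refine Finset.sum_eq_zero (fun H hH => ?_)
  obtain ⟨hHG, hHr, hHs⟩ := trace_facts_of_mem_flatsTr hG hH
  rw [spFm_eq_card_Pc hHs hjs]
  exact card_Pc_eq_zero_of_nonbasis hs hHG hr (d := s - r) (by omega) (by omega) hm

/-- **(T4b)** the bases of a trace have exactly `r` coloops: `SPm_{s, r, m} = 0` for `m ≠ r`. -/
theorem spSumM_eq_zero_of_basis {G : Finset α} {r s m : ℕ} (hrs : r ≤ s) (hm : m ≠ r) :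
    spSumM M G r s r m = 0 := by
  unfold spSumM
  refine Finset.sum_eq_zero (fun H hH => ?_)
  have hHs : (H ∩ G).card = s := (mem_flatsTr.1 hH).2.1
  rw [spFm_eq_card_Pc hHs hrs]
  exact card_Pc_eq_zero_of_basis (d := s - r) (by omega) hm

/-- **(T0z)** the whole trace is its own spanning `s`-subset: `SP_{s,s} = h_s`. -/
theorem spSum_self_eq_hypTr {G : Finset α} (r s : ℕ) : spSum M G r s s = hypTr M G r s := by
  unfold spSum hypTr
  rw [Finset.card_eq_sum_ones]
  refine Finset.sum_congr rfl (fun H hH => ?_)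
  have hHs : (H ∩ G).card = s := (mem_flatsTr.1 hH).2.1
  have hHr : M.eRk ((H ∩ G : Finset α) : Set α) = (r : ℕ∞) := (mem_flatsTr.1 hH).2.2
  unfold spF
  rw [← hHs, Finset.powersetCard_self, Finset.filter_singleton, if_pos hHr, Finset.card_singleton]

end PercRepro.Night4
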